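import Summits.Ventures.HodgeRepro2.T5WeightDecomposition

/-!
# Independence of the weight spaces of a commutative group — `V = ⨁_χ V_χ`

For a representation `π : K →* V →L[ℂ] V` of a COMMUTATIVE group `K` on a finite-dimensional
complex inner-product space `V`, the weight spaces `weightSpace π χ = {v | ∀ k, π k v = χ k • v}`
(`χ : K →* ℂˣ`) are linearly independent (`iSupIndep`).  This is the general compact-abelian form
of `T5CircleWeightSpaces.iSupIndep_weightSpace_zpowChar` (there `K = Circle` and the independence
came from the eigenspaces of the single operator `π z₀`); here it comes from Mathlib's independence
of the simultaneous generalised eigenspaces of a commuting family of endomorphisms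
(`Module.End.independent_iInf_maxGenEigenspace_of_forall_mapsTo`), since a weight space is
contained in the simultaneous eigenspace of the family `k ↦ π k` for the eigenvalues `k ↦ χ k`.

Consequences (for a compact Hausdorff `K` and a continuous `π`, where
`T5WeightDecomposition.exists_weight_decomposition` supplies `⨆_χ V_χ = ⊤`):
* `isInternal_weightSpace` — `V = ⨁_χ V_χ` as an internal direct sum, indexed by ALL characters;
* `finite_setOf_weightSpace_ne_bot` / `weights` — only finitely many weights occur;
* `character_eq_sum_finrank_mul` — `χ_π(k) = Σ_{χ ∈ weights π} dim V_χ · χ(k)`;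
* `sum_finrank_weightSpace` — `Σ_χ dim V_χ = dim V`.

Blind lane: Mathlib + own prefix only; no sorry; axioms ⊆ {propext, Classical.choice, Quot.sound}.
-/

namespace Summit.Ventures.HodgeRepro2.T5AbelianWeightIndependence

open T5WeightSpaces T5WeightDecomposition

variable {K : Type*} [Group K] {V : Type*} [NormedAddCommGroup V] [InnerProductSpace ℂ V]

/-- The operator `π k`, viewed as a plain linear endomorphism of `V`. -/
def endo (π : K →* V →L[ℂ] V) (k : K) : Module.End ℂ V := (π k : V →ₗ[ℂ] V)

/-- `endo π k v = π k v`. -/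
theorem endo_apply (π : K →* V →L[ℂ] V) (k : K) (v : V) : endo π k v = π k v := rfl

/-- `χ_π(1) = dim V`. -/
theorem character_one [FiniteDimensional ℂ V] (π : K →* V →L[ℂ] V) :
    T5SchurOrthogonality.character π 1 = (Module.finrank ℂ V : ℂ) := by
  change LinearMap.trace ℂ V (endo π 1) = _
  have : endo π 1 = LinearMap.id := by
    ext v
    simp only [endo_apply, map_one, one_apply_eq_self, LinearMap.id_apply]
  rw [this, LinearMap.trace_id]

/-- For a commutative group the operators `π j`, `π i` commute. -/
theorem commute_endo [IsMulCommutative K] (π : K →* V →L[ℂ] V) (j i : K) :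
    Commute (endo π j) (endo π i) := by
  refine LinearMap.ext fun v => ?_
  simp only [Module.End.mul_apply, endo_apply]
  have h1 : (π j) ((π i) v) = (π (j * i)) v := by rw [map_mul, mul_apply_eq_comp]
  have h2 : (π i) ((π j) v) = (π (i * j)) v := by rw [map_mul, mul_apply_eq_comp]
  rw [h1, h2, IsMulCommutative.is_comm.comm j i]

/-- A weight space is contained in the simultaneous (maximal generalised) eigenspace of the
family `k ↦ π k` for the eigenvalues `k ↦ χ k`. -/
theorem weightSpace_le_iInf_maxGenEigenspace (π : K →* V →L[ℂ] V) (χ : K →* ℂˣ) :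
    weightSpace π χ ≤ ⨅ k, (endo π k).maxGenEigenspace ((χ k : ℂˣ) : ℂ) := by
  intro v hv
  rw [Submodule.mem_iInf]
  intro k
  apply Module.End.eigenspace_le_maxGenEigenspace
  rw [Module.End.mem_eigenspace_iff]
  exact (mem_weightSpace π χ).1 hv k

/-- The map `χ ↦ (k ↦ χ k)` from characters to functions `K → ℂ` is injective. -/
theorem injective_toFun : Function.Injective fun χ : K →* ℂˣ => fun k => ((χ k : ℂˣ) : ℂ) := by
  intro χ χ' h
  ext k
  exact congrFun h k

/-- **Independence of the weight spaces** of a commutative group: the family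
`χ ↦ weightSpace π χ` (over all characters `χ : K →* ℂˣ`) is `iSupIndep`.  No topology and no
finite-dimensionality is needed. -/
theorem iSupIndep_weightSpace [IsMulCommutative K] (π : K →* V →L[ℂ] V) :
    iSupIndep fun χ : K →* ℂˣ => weightSpace π χ := by
  have hind : iSupIndep fun χ : K → ℂ => ⨅ k, (endo π k).maxGenEigenspace (χ k) :=
    Module.End.independent_iInf_maxGenEigenspace_of_forall_mapsTo (endo π)
      (fun i j φ => Module.End.mapsTo_maxGenEigenspace_of_comm (commute_endo π j i) φ)
  exact (hind.comp injective_toFun).mono fun χ => weightSpace_le_iInf_maxGenEigenspace π χ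

section FiniteDimensional

variable [IsMulCommutative K] [FiniteDimensional ℂ V]

/-- Only finitely many weight spaces are non-zero. -/
theorem finite_setOf_weightSpace_ne_bot (π : K →* V →L[ℂ] V) :
    {χ : K →* ℂˣ | weightSpace π χ ≠ ⊥}.Finite :=
  Submodule.finite_ne_bot_of_iSupIndep (iSupIndep_weightSpace π)

/-- The finite set of weights of `π` (the characters with a non-zero weight space). -/
noncomputable def weights (π : K →* V →L[ℂ] V) : Finset (K →* ℂˣ) :=
  (finite_setOf_weightSpace_ne_bot π).toFinset

/-- `χ ∈ weights π ↔ weightSpace π χ ≠ ⊥`. -/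
theorem mem_weights (π : K →* V →L[ℂ] V) (χ : K →* ℂˣ) :
    χ ∈ weights π ↔ weightSpace π χ ≠ ⊥ := by
  simp only [weights, Set.Finite.mem_toFinset, Set.mem_setOf_eq]

/-- `χ ∈ weights π ↔ dim V_χ ≠ 0`. -/
theorem mem_weights_iff_finrank_ne_zero (π : K →* V →L[ℂ] V) (χ : K →* ℂˣ) :
    χ ∈ weights π ↔ Module.finrank ℂ (weightSpace π χ) ≠ 0 := by
  rw [mem_weights, Ne, Ne, Submodule.finrank_eq_zero]

/-- The weight of an irreducible (one-dimensional) stable subspace is a weight of `π`. -/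
theorem lineWeight_mem_weights (π : K →* V →L[ℂ] V) {W : Submodule ℂ V}
    (hW : T5CompleteReducibility.IsIrreducibleSubspace π W) :
    lineWeight π hW ∈ weights π := by
  rw [mem_weights, Submodule.ne_bot_iff]
  exact ⟨lineVector π hW, le_weightSpace_lineWeight π hW (lineVector_mem π hW),
    lineVector_ne_zero π hW⟩

omit [FiniteDimensional ℂ V] in
/-- `π k` maps every weight space into itself. -/
theorem mapsTo_endo_weightSpace (π : K →* V →L[ℂ] V) (k : K) (χ : K →* ℂˣ) :
    Set.MapsTo (endo π k) (weightSpace π χ) (weightSpace π χ) :=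
  fun _ hv => isStable_weightSpace π χ k _ hv

omit [FiniteDimensional ℂ V] in
/-- On the weight space `V_χ` the operator `π k` is the scalar `χ k`. -/
theorem restrict_endo_eq_smul_id (π : K →* V →L[ℂ] V) (k : K) (χ : K →* ℂˣ) :
    (endo π k).restrict (mapsTo_endo_weightSpace π k χ) = ((χ k : ℂˣ) : ℂ) • LinearMap.id := by
  ext ⟨v, hv⟩
  simp only [LinearMap.restrict_apply, endo_apply, LinearMap.smul_apply, LinearMap.id_apply,
    Submodule.coe_smul]
  exact (mem_weightSpace π χ).1 hv k

/-- The trace of `π k` on the weight space `V_χ` is `dim V_χ · χ k`. -/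
theorem trace_restrict_endo (π : K →* V →L[ℂ] V) (k : K) (χ : K →* ℂˣ) :
    LinearMap.trace ℂ (weightSpace π χ) ((endo π k).restrict (mapsTo_endo_weightSpace π k χ)) =
      (Module.finrank ℂ (weightSpace π χ) : ℂ) * ((χ k : ℂˣ) : ℂ) := by
  rw [restrict_endo_eq_smul_id, map_smul, LinearMap.trace_id, smul_eq_mul, mul_comm]

/-- Every weight `χ` of `π` has a non-zero weight vector (it spans a stable line of weight `χ`). -/
theorem exists_line_of_mem_weights (π : K →* V →L[ℂ] V) {χ : K →* ℂˣ} (hχ : χ ∈ weights π) :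
    ∃ v : V, v ≠ 0 ∧ ∀ k, π k v = ((χ k : ℂˣ) : ℂ) • v := by
  rw [mem_weights, Submodule.ne_bot_iff] at hχ
  obtain ⟨v, hv, hv0⟩ := hχ
  exact ⟨v, hv0, (mem_weightSpace π χ).1 hv⟩

section Compact

variable [TopologicalSpace K] [IsTopologicalGroup K] [MeasurableSpace K] [BorelSpace K]
  [CompactSpace K] [T2Space K]

/-- For a continuous representation of a compact Hausdorff commutative group the weight spaces
span: `⨆_χ V_χ = ⊤` (from the decomposition into stable lines of
`T5WeightDecomposition.exists_weight_decomposition`). -/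
theorem iSup_weightSpace_eq_top (π : K →* V →L[ℂ] V) (hπ : Continuous π) :
    ⨆ χ : K →* ℂˣ, weightSpace π χ = ⊤ := by
  obtain ⟨S, hS, -, -, -, htop⟩ := exists_weight_decomposition π hπ
  refine top_unique ?_
  rw [← htop]
  exact iSup_le fun W => le_iSup (fun χ : K →* ℂˣ => weightSpace π χ) (lineWeight π (hS W W.2))

/-- **The weight decomposition** `V = ⨁_χ V_χ` of a continuous finite-dimensional representation
of a compact Hausdorff commutative group, as an internal direct sum indexed by all characters. -/
theorem isInternal_weightSpace [DecidableEq (K →* ℂˣ)] (π : K →* V →L[ℂ] V)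
    (hπ : Continuous π) :
    DirectSum.IsInternal fun χ : K →* ℂˣ => weightSpace π χ :=
  DirectSum.isInternal_submodule_of_iSupIndep_of_iSup_eq_top (iSupIndep_weightSpace π)
    (iSup_weightSpace_eq_top π hπ)

/-- **The character as a sum of weights**: `χ_π(k) = Σ_{χ ∈ weights π} dim V_χ · χ(k)`
(`LinearMap.trace_eq_sum_trace_restrict'` on the weight decomposition). -/
theorem character_eq_sum_finrank_mul (π : K →* V →L[ℂ] V) (hπ : Continuous π) (k : K) :
    T5SchurOrthogonality.character π k =
      ∑ χ ∈ weights π, (Module.finrank ℂ (weightSpace π χ) : ℂ) * ((χ k : ℂˣ) : ℂ) := by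
  classical
  have hint := isInternal_weightSpace π hπ
  have hfin := finite_setOf_weightSpace_ne_bot π
  have htr := LinearMap.trace_eq_sum_trace_restrict' hint hfin
    (f := endo π k) (fun χ => mapsTo_endo_weightSpace π k χ)
  change LinearMap.trace ℂ V (endo π k) = _
  rw [htr]
  refine Finset.sum_congr rfl fun χ _ => ?_
  exact trace_restrict_endo π k χ

/-- **Dimension bookkeeping**: `Σ_{χ ∈ weights π} dim V_χ = dim V`. -/
theorem sum_finrank_weightSpace (π : K →* V →L[ℂ] V) (hπ : Continuous π) :
    ∑ χ ∈ weights π, Module.finrank ℂ (weightSpace π χ) = Module.finrank ℂ V := by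
  have h := character_eq_sum_finrank_mul π hπ 1
  rw [character_one] at h
  simp only [map_one, Units.val_one, mul_one] at h
  exact_mod_cast h.symm

end Compact

end FiniteDimensional

end Summit.Ventures.HodgeRepro2.T5AbelianWeightIndependence
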